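import Summits.AnomalousDissipation.AnomalousDissipation.Theorems.MarginalStabilityChainStrainedLayerLawStubMomentPairKernelStrip

/-!
# Stub `stub_momentPairKernel` (crux stmt-AnomalousDissipation-3007) — tools C: Green's identity at level `ε`
# and the approximate velocity `u_ε`

Support file (`--supports stmt-AnomalousDissipation-3007`), third brick of `stub_momentPairKernel`. For one slice
`(u, v)` satisfying the stub's hypotheses (`C²`, `∂ₓu + ∂_yv = 0`, `L`-periodic, `u → ±½` as `y → ±∞`,
`SliceTails C k u v`) and `0 < ε ≤ 1`:

  `∫_{(0,L]×ℝ} K₁^ε(z − ζ) ω(ζ) dζ = −(L/2π) ∫_{(0,L]×ℝ} ΔΦ_ε^L(z − ζ) u(ζ) dζ`   (`ω = ∂ₓv − ∂_yu`)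

(`integral_kerU_mul_vorticity`), by FOUR one-dimensional integrations by parts on the strip with the smooth bounded
kernels of tools A: periodic in `x′` twice (Literature `integral_strip_mul_dX_eq_neg`), in `y′` once without
boundary terms (`integral_strip_mul_dY_eq_neg`) and once WITH the fluxes `K₁^ε u → −½` at `y′ → ±∞`, which cancel
(tools B `integral_strip_mul_dY_eq_neg_of_tendsto` — this is where the shear far field enters), `div = 0`, and
`ΔΦ_ε = (2π/L)²(∂ₜK₁^ε + ∂ₛK₂^ε)`. Then the APPROXIMATE VELOCITY `uReg L ε u = (4π)⁻¹ ∫_{S_L} ΔΦ_ε^L(q) u(· − q) dq`: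
`u_ε → u` pointwise as `ε → 0⁺` (the tools' `RowBiotSavart.tendsto_integral_lap_mul`), `|u_ε| ≤ sup|u|` (mass `4π`),
joint continuity, and THE REPRESENTATION `u_ε(x,y) = −(2L)⁻¹ ∫_{x′∈(0,L]} ∫_{y′} K₁^ε(x − x′, y − y′) ω(x′, y′)`
(Green's identity, the cell shift of tools B, Fubini) — the level-`ε` cylinder Biot–Savart law for the GIVEN field;
finally `pairKernelReg L ε δ → pairKernel L δ` at every `δ`. Registered sub-goal proved here:
`stub_momentPairKernel_greenReg`. All `[folklore]`.
-/

-- `Summit.<Summit>.<Problem>` is the tree's mandated summit-side namespace (CONVENTIONS §2); for this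
-- single-conjunct summit the two coincide, so the duplicate is deliberate.
set_option linter.dupNamespace false

noncomputable section

open scoped Topology
open Filter Set Function MeasureTheory Real

namespace Summit.AnomalousDissipation.AnomalousDissipation.Theorems.StrainedLayerLaw.StrainWorkSumRule

open Summit.AnomalousDissipation.AnomalousDissipation.Theorems.MarginalStabilityChainStretchedVortexRows
open Literature.Analysis.FluidPDE Literature.Analysis.FluidPDE.StretchedLayer

/-! ### Green's identity at level `ε`: `∫ K₁^ε(z − ζ) ω(ζ) = −(L/2π) ∫ ΔΦ_ε(z − ζ) u(ζ)` -/

section Green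

variable {L C k ε : ℝ} {u v : ℝ → ℝ → ℝ}

/-- Continuity of a shifted kernel slice in `x′`. [folklore] -/
theorem continuous_shift_fst {K : ℝ → ℝ → ℝ} (hK : Continuous fun p : ℝ × ℝ => K p.1 p.2) (x y b : ℝ) :
    Continuous fun a : ℝ => K (x - a) (y - b) :=
  hK.comp ((continuous_const.sub continuous_id).prodMk continuous_const)

/-- Continuity of a shifted kernel in both variables. [folklore] -/
theorem continuous_shift {K : ℝ → ℝ → ℝ} (hK : Continuous fun p : ℝ × ℝ => K p.1 p.2) (x y : ℝ) :
    Continuous fun p : ℝ × ℝ => K (x - p.1) (y - p.2) :=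
  hK.comp ((continuous_const.sub continuous_fst).prodMk (continuous_const.sub continuous_snd))

/-- (a) `∫ K₁^ε(z−ζ) ∂ₓv = −∫ (2π/L) kerUV(z−ζ) v` (periodic IBP in `x′`). [folklore] -/
theorem integral_kerU_mul_dXv (hL : 0 < L) (hk : 0 < k) (hv : ContDiff ℝ 2 (fun q : ℝ × ℝ => v q.1 q.2))
    (hperv : ∀ x y, v (x + L) y = v x y) (hT : SliceTails C k u v) (hε : 0 < ε) (x y : ℝ) :
    ∫ q in Ioc 0 L ×ˢ univ, kerU L ε (x - q.1) (y - q.2) * dX v q.1 q.2 =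
      -∫ q in Ioc 0 L ×ˢ univ, (2 * π / L * kerUV L ε (x - q.1) (y - q.2)) * v q.1 q.2 := by
  refine integral_strip_mul_dX_eq_neg hL.le (f := fun a b => kerU L ε (x - a) (y - b)) (g := v)
    (f' := fun a b => 2 * π / L * kerUV L ε (x - a) (y - b)) (g' := dX v)
    (fun a b => hasDerivAt_kerU_fst hε L x y a b) (fun a b => hasDerivAt_dX_of_contDiff hv two_ne_zero a b)
    (fun b => continuous_const.mul (continuous_shift_fst (continuous_kerUV hε L) x y b))
    (fun b => (contDX hv).comp (continuous_id.prodMk continuous_const)) (fun b => ?_) ?_ ?_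
  · show kerU L ε (x - L) (y - b) * v L b = kerU L ε (x - 0) (y - b) * v 0 b
    have hv0 : v L b = v 0 b := by rw [← hperv 0 b, zero_add]
    rw [sub_zero, hv0, ← kerU_add_period hL.ne' ε (x - L), sub_add_cancel]
  · exact integrableOn_strip_bdd_mul_decay hk (K := fun a b => kerU L ε (x - a) (y - b)) (w := dX v)
      (continuous_shift (continuous_kerU hε L) x y) (contDX hv)
      (fun a b => abs_kerU_le hε L _ _) (tails_C_nonneg hT) (tails_abs_dXv_le hT)
  · exact integrableOn_strip_bdd_mul_decay hk (K := fun a b => 2 * π / L * kerUV L ε (x - a) (y - b))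
      (w := v) (continuous_const.mul (continuous_shift (continuous_kerUV hε L) x y)) hv.continuous
      (fun a b => by rw [abs_mul]; exact mul_le_mul_of_nonneg_left (abs_kerUV_le hε L _ _) (abs_nonneg _))
      (tails_C_nonneg hT) (tails_abs_v_le hT)

/-- (b) `∫ v (2π/L) kerUV(z−ζ) = −∫ ∂_yv K₂^ε(z−ζ)` (IBP in `y′`, no boundary terms). [folklore] -/
theorem integral_v_mul_kerUV (hk : 0 < k) (hv : ContDiff ℝ 2 (fun q : ℝ × ℝ => v q.1 q.2))
    (hT : SliceTails C k u v) (hε : 0 < ε) (x y : ℝ) :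
    ∫ q in Ioc 0 L ×ˢ univ, v q.1 q.2 * (2 * π / L * kerUV L ε (x - q.1) (y - q.2)) =
      -∫ q in Ioc 0 L ×ˢ univ, dY v q.1 q.2 * kerV L ε (x - q.1) (y - q.2) := by
  refine integral_strip_mul_dY_eq_neg (f := v) (g := fun a b => kerV L ε (x - a) (y - b)) (f' := dY v)
    (g' := fun a b => 2 * π / L * kerUV L ε (x - a) (y - b))
    (fun a b => hasDerivAt_dY_of_contDiff hv two_ne_zero a b) (fun a b => hasDerivAt_kerV_snd hε L x y a b)
    ?_ ?_ ?_
  · exact integrableOn_strip_decay_mul_bdd hk (K := fun a b => 2 * π / L * kerUV L ε (x - a) (y - b))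
      (w := v) (continuous_const.mul (continuous_shift (continuous_kerUV hε L) x y)) hv.continuous
      (fun a b => by rw [abs_mul]; exact mul_le_mul_of_nonneg_left (abs_kerUV_le hε L _ _) (abs_nonneg _))
      (tails_C_nonneg hT) (tails_abs_v_le hT)
  · exact integrableOn_strip_decay_mul_bdd hk (K := fun a b => kerV L ε (x - a) (y - b)) (w := dY v)
      (continuous_shift (continuous_kerV hε L) x y) (contDY hv)
      (fun a b => abs_kerV_le hε L _ _) (tails_C_nonneg hT) (tails_abs_dYv_le hT)
  · exact integrableOn_strip_decay_mul_bdd hk (K := fun a b => kerV L ε (x - a) (y - b)) (w := v)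
      (continuous_shift (continuous_kerV hε L) x y) hv.continuous
      (fun a b => abs_kerV_le hε L _ _) (tails_C_nonneg hT) (tails_abs_v_le hT)

/-- (c) `∫ K₂^ε(z−ζ) ∂ₓu = −∫ (−(2π/L) kerVV(z−ζ)) u` (periodic IBP in `x′`). [folklore] -/
theorem integral_kerV_mul_dXu (hL : 0 < L) (hk : 0 < k) (hu : ContDiff ℝ 2 (fun q : ℝ × ℝ => u q.1 q.2))
    (hperu : ∀ x y, u (x + L) y = u x y) (hT : SliceTails C k u v) (hε : 0 < ε) (hε1 : ε ≤ 1) (x y : ℝ) :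
    ∫ q in Ioc 0 L ×ˢ univ, kerV L ε (x - q.1) (y - q.2) * dX u q.1 q.2 =
      -∫ q in Ioc 0 L ×ˢ univ, (-(2 * π / L) * kerVV L ε (x - q.1) (y - q.2)) * u q.1 q.2 := by
  refine integral_strip_mul_dX_eq_neg hL.le (f := fun a b => kerV L ε (x - a) (y - b)) (g := u)
    (f' := fun a b => -(2 * π / L) * kerVV L ε (x - a) (y - b)) (g' := dX u)
    (fun a b => hasDerivAt_kerV_fst hε L x y a b) (fun a b => hasDerivAt_dX_of_contDiff hu two_ne_zero a b)
    (fun b => continuous_const.mul (continuous_shift_fst (continuous_kerVV hε L) x y b))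
    (fun b => (contDX hu).comp (continuous_id.prodMk continuous_const)) (fun b => ?_) ?_ ?_
  · show kerV L ε (x - L) (y - b) * u L b = kerV L ε (x - 0) (y - b) * u 0 b
    have hu0 : u L b = u 0 b := by rw [← hperu 0 b, zero_add]
    rw [sub_zero, hu0, ← kerV_add_period hL.ne' ε (x - L), sub_add_cancel]
  · exact integrableOn_strip_bdd_mul_decay hk (K := fun a b => kerV L ε (x - a) (y - b)) (w := dX u)
      (continuous_shift (continuous_kerV hε L) x y) (contDX hu)
      (fun a b => abs_kerV_le hε L _ _) (tails_C_nonneg hT) (tails_abs_dXu_le hT)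
  · refine integrableOn_strip_decayKer_mul_bdd (K := fun a b => -(2 * π / L) * kerVV L ε (x - a) (y - b))
      (w := u) (continuous_const.mul (continuous_shift (continuous_kerVV hε L) x y)) hu.continuous
      (A := 2 * π / L * ((1 / ε + (1 / ε) ^ 2 + 24) * Real.exp 2)) (by positivity : (0:ℝ) < 2 * π / L) y
      (fun a b => ?_) (tails_abs_u_le hT hk)
    rw [abs_mul, abs_neg, abs_of_pos (by positivity : (0:ℝ) < 2 * π / L), mul_assoc]
    exact mul_le_mul_of_nonneg_left (abs_kerVV_le hL hε hε1 _ _) (by positivity)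

/-- (d) `∫ K₁^ε(z−ζ) ∂_yu = −∫ (−(2π/L) kerUU(z−ζ)) u` (IBP in `y′`; the fluxes `K₁^ε u → −½` at BOTH ends
cancel — this is where the shear far field `u → ±½` enters). [folklore] -/
theorem integral_kerU_mul_dYu (hL : 0 < L) (hk : 0 < k) (hu : ContDiff ℝ 2 (fun q : ℝ × ℝ => u q.1 q.2))
    (htop : ∀ x, Tendsto (fun y => u x y) atTop (𝓝 (1 / 2)))
    (hbot : ∀ x, Tendsto (fun y => u x y) atBot (𝓝 (-(1 / 2)))) (hT : SliceTails C k u v) (hε : 0 < ε)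
    (hε1 : ε ≤ 1) (x y : ℝ) :
    ∫ q in Ioc 0 L ×ˢ univ, kerU L ε (x - q.1) (y - q.2) * dY u q.1 q.2 =
      -∫ q in Ioc 0 L ×ˢ univ, (-(2 * π / L) * kerUU L ε (x - q.1) (y - q.2)) * u q.1 q.2 := by
  refine integral_strip_mul_dY_eq_neg_of_tendsto (f := fun a b => kerU L ε (x - a) (y - b)) (g := u)
    (f' := fun a b => -(2 * π / L) * kerUU L ε (x - a) (y - b)) (g' := dY u) (l := fun _ => -(1 / 2))
    (fun a b => hasDerivAt_kerU_snd hε L x y a b) (fun a b => hasDerivAt_dY_of_contDiff hu two_ne_zero a b)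
    ?_ ?_ (fun a => ?_) (fun a => ?_)
  · exact integrableOn_strip_bdd_mul_decay hk (K := fun a b => kerU L ε (x - a) (y - b)) (w := dY u)
      (continuous_shift (continuous_kerU hε L) x y) (contDY hu)
      (fun a b => abs_kerU_le hε L _ _) (tails_C_nonneg hT) (tails_abs_dYu_le hT)
  · refine integrableOn_strip_decayKer_mul_bdd (K := fun a b => -(2 * π / L) * kerUU L ε (x - a) (y - b))
      (w := u) (continuous_const.mul (continuous_shift (continuous_kerUU hε L) x y)) hu.continuous
      (A := 2 * π / L * (((2 + 2 / ε) + (2 + 2 / ε) ^ 2 + 24) * Real.exp 2))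
      (by positivity : (0:ℝ) < 2 * π / L) y (fun a b => ?_) (tails_abs_u_le hT hk)
    rw [abs_mul, abs_neg, abs_of_pos (by positivity : (0:ℝ) < 2 * π / L), mul_assoc]
    exact mul_le_mul_of_nonneg_left (abs_kerUU_le hL hε hε1 _ _) (by positivity)
  · have := (tendsto_kerU_atBot hL hε.le x a y).mul (hbot a)
    rwa [one_mul] at this
  · have := (tendsto_kerU_atTop hL hε.le x a y).mul (htop a)
    rwa [show (-1 : ℝ) * (1 / 2) = -(1 / 2) by ring] at this

/-- **Green's identity at level `ε`**: `∫_cell K₁^ε(z − ζ) ω(ζ) dζ = −(L/2π) ∫_cell ΔΦ_ε^L(z − ζ) u(ζ) dζ`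
(`ω = ∂ₓv − ∂_yu`; (a)–(d) and `div = 0`). [folklore] -/
theorem integral_kerU_mul_vorticity (hL : 0 < L) (hk : 0 < k) (hu : ContDiff ℝ 2 (fun q : ℝ × ℝ => u q.1 q.2))
    (hv : ContDiff ℝ 2 (fun q : ℝ × ℝ => v q.1 q.2)) (hdiv : ∀ x y, dX u x y + dY v x y = 0)
    (hperu : ∀ x y, u (x + L) y = u x y) (hperv : ∀ x y, v (x + L) y = v x y)
    (htop : ∀ x, Tendsto (fun y => u x y) atTop (𝓝 (1 / 2)))
    (hbot : ∀ x, Tendsto (fun y => u x y) atBot (𝓝 (-(1 / 2)))) (hT : SliceTails C k u v) (hε : 0 < ε)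
    (hε1 : ε ≤ 1) (x y : ℝ) :
    ∫ q in Ioc 0 L ×ˢ univ, kerU L ε (x - q.1) (y - q.2) * vorticity u v q.1 q.2 =
      -(L / (2 * π)) * ∫ q in Ioc 0 L ×ˢ univ, bump L ε (x - q.1) (y - q.2) * u q.1 q.2 := by
  have hc : (0:ℝ) < 2 * π / L := by positivity
  set S : Set (ℝ × ℝ) := Ioc 0 L ×ˢ univ
  -- integrability of the pieces
  have iA : IntegrableOn (fun q : ℝ × ℝ => kerU L ε (x - q.1) (y - q.2) * dX v q.1 q.2) S :=
    integrableOn_strip_bdd_mul_decay hk (K := fun a b => kerU L ε (x - a) (y - b)) (w := dX v)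
      (continuous_shift (continuous_kerU hε L) x y) (contDX hv)
      (fun a b => abs_kerU_le hε L _ _) (tails_C_nonneg hT) (tails_abs_dXv_le hT)
  have iD : IntegrableOn (fun q : ℝ × ℝ => kerU L ε (x - q.1) (y - q.2) * dY u q.1 q.2) S :=
    integrableOn_strip_bdd_mul_decay hk (K := fun a b => kerU L ε (x - a) (y - b)) (w := dY u)
      (continuous_shift (continuous_kerU hε L) x y) (contDY hu)
      (fun a b => abs_kerU_le hε L _ _) (tails_C_nonneg hT) (tails_abs_dYu_le hT)
  have iUU : IntegrableOn (fun q : ℝ × ℝ => (-(2 * π / L) * kerUU L ε (x - q.1) (y - q.2)) * u q.1 q.2) S := by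
    refine integrableOn_strip_decayKer_mul_bdd (K := fun a b => -(2 * π / L) * kerUU L ε (x - a) (y - b))
      (w := u) (continuous_const.mul (continuous_shift (continuous_kerUU hε L) x y)) hu.continuous
      (A := 2 * π / L * (((2 + 2 / ε) + (2 + 2 / ε) ^ 2 + 24) * Real.exp 2)) hc y (fun a b => ?_) (tails_abs_u_le hT hk)
    rw [abs_mul, abs_neg, abs_of_pos hc, mul_assoc]
    exact mul_le_mul_of_nonneg_left (abs_kerUU_le hL hε hε1 _ _) hc.le
  have iVV : IntegrableOn (fun q : ℝ × ℝ => (-(2 * π / L) * kerVV L ε (x - q.1) (y - q.2)) * u q.1 q.2) S := by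
    refine integrableOn_strip_decayKer_mul_bdd (K := fun a b => -(2 * π / L) * kerVV L ε (x - a) (y - b))
      (w := u) (continuous_const.mul (continuous_shift (continuous_kerVV hε L) x y)) hu.continuous
      (A := 2 * π / L * ((1 / ε + (1 / ε) ^ 2 + 24) * Real.exp 2)) hc y (fun a b => ?_) (tails_abs_u_le hT hk)
    rw [abs_mul, abs_neg, abs_of_pos hc, mul_assoc]
    exact mul_le_mul_of_nonneg_left (abs_kerVV_le hL hε hε1 _ _) hc.le
  -- split `ω = ∂ₓv − ∂_yu`
  have hsplit : (∫ q in S, kerU L ε (x - q.1) (y - q.2) * vorticity u v q.1 q.2) =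
      (∫ q in S, kerU L ε (x - q.1) (y - q.2) * dX v q.1 q.2) -
        ∫ q in S, kerU L ε (x - q.1) (y - q.2) * dY u q.1 q.2 := by
    rw [← integral_sub iA iD]
    refine integral_congr_ae (Eventually.of_forall fun q => ?_)
    simp only [vorticity]; ring
  -- the `∂ₓv` piece: (a), (b), `div = 0`, (c)
  have hA : (∫ q in S, kerU L ε (x - q.1) (y - q.2) * dX v q.1 q.2) =
      ∫ q in S, (-(2 * π / L) * kerVV L ε (x - q.1) (y - q.2)) * u q.1 q.2 := by
    rw [integral_kerU_mul_dXv hL hk hv hperv hT hε x y]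
    have e1 : (∫ q in S, (2 * π / L * kerUV L ε (x - q.1) (y - q.2)) * v q.1 q.2) =
        ∫ q in S, v q.1 q.2 * (2 * π / L * kerUV L ε (x - q.1) (y - q.2)) :=
      integral_congr_ae (Eventually.of_forall fun q => mul_comm _ _)
    rw [e1, integral_v_mul_kerUV hk hv hT hε x y, neg_neg]
    have e2 : (∫ q in S, dY v q.1 q.2 * kerV L ε (x - q.1) (y - q.2)) =
        -∫ q in S, kerV L ε (x - q.1) (y - q.2) * dX u q.1 q.2 := by
      rw [← MeasureTheory.integral_neg]
      refine integral_congr_ae (Eventually.of_forall fun q => ?_)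
      have hd := hdiv q.1 q.2
      show dY v q.1 q.2 * kerV L ε (x - q.1) (y - q.2) = -(kerV L ε (x - q.1) (y - q.2) * dX u q.1 q.2)
      rw [show dY v q.1 q.2 = -dX u q.1 q.2 by linarith]; ring
    rw [e2, integral_kerV_mul_dXu hL hk hu hperu hT hε hε1 x y, neg_neg]
  rw [hsplit, hA, integral_kerU_mul_dYu hL hk hu htop hbot hT hε hε1 x y, sub_neg_eq_add, ← integral_add iVV iUU,
    ← integral_const_mul]
  refine integral_congr_ae (Eventually.of_forall fun q => ?_)
  show -(2 * π / L) * kerVV L ε (x - q.1) (y - q.2) * u q.1 q.2 +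
      -(2 * π / L) * kerUU L ε (x - q.1) (y - q.2) * u q.1 q.2 =
    -(L / (2 * π)) * (bump L ε (x - q.1) (y - q.2) * u q.1 q.2)
  rw [bump_eq hε]
  field_simp
  ring

end Green

/-! ### The regularised velocity `u_ε = (4π)⁻¹ ∫_{S_L} ΔΦ_ε^L(q) u(z − q) dq` -/

/-- `u_ε(x, y) = (4π)⁻¹ ∫_{S_L} ΔΦ_ε^L(q) u(x − q₁, y − q₂) dq` (the tools' kernel-first form). [folklore] -/
def uReg (L ε : ℝ) (u : ℝ → ℝ → ℝ) (x y : ℝ) : ℝ :=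
  1 / (4 * π) * ∫ q in Ioc (-(L / 2)) (L / 2) ×ˢ univ, bump L ε q.1 q.2 * u (x - q.1) (y - q.2)

section UReg

variable {L C k ε : ℝ} {u v : ℝ → ℝ → ℝ}

/-- `ΔΦ_ε^L` is integrable on `S_L` (the tools). [folklore] -/
theorem integrable_bump (hL : 0 < L) (hε : 0 < ε) (hε1 : ε ≤ 1) :
    Integrable (fun q : ℝ × ℝ => bump L ε q.1 q.2)
      ((volume : Measure (ℝ × ℝ)).restrict (Ioc (-(L / 2)) (L / 2) ×ˢ univ)) :=
  RowBiotSavart.integrable_lapRowLogKerReg hL hε hε1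

/-- `∫_{S_L} ΔΦ_ε^L = 4π` (the tools). [folklore] -/
theorem integral_bump (hL : 0 < L) (hε : 0 < ε) (hε1 : ε ≤ 1) :
    ∫ q in Ioc (-(L / 2)) (L / 2) ×ˢ univ, bump L ε q.1 q.2 = 4 * π :=
  RowBiotSavart.integral_lapRowLogKerReg hL hε hε1

/-- **`u_ε → u` pointwise** as `ε → 0⁺` (the approximate identity of the tools). [folklore] -/
theorem tendsto_uReg (hL : 0 < L) (hu : Continuous fun p : ℝ × ℝ => u p.1 p.2) {M : ℝ}
    (hM : ∀ x y, |u x y| ≤ M) (x y : ℝ) :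
    Tendsto (fun ε => uReg L ε u x y) (𝓝[>] 0) (𝓝 (u x y)) := by
  have hc : Continuous fun q : ℝ × ℝ => u (x - q.1) (y - q.2) := continuous_shift hu x y
  have h := (RowBiotSavart.tendsto_integral_lap_mul hL hc (M := M) fun q => hM _ _).const_mul (1 / (4 * π))
  simp only [Prod.fst_zero, Prod.snd_zero, sub_zero] at h
  rw [show 1 / (4 * π) * (4 * π * u x y) = u x y by field_simp] at h
  exact h

/-- **`|u_ε| ≤ sup|u|`** for `0 < ε ≤ 1` (positivity and mass `4π` of the bump). [folklore] -/
theorem abs_uReg_le (hL : 0 < L) (hε : 0 < ε) (hε1 : ε ≤ 1) (hu : Continuous fun p : ℝ × ℝ => u p.1 p.2)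
    {M : ℝ} (hM : ∀ x y, |u x y| ≤ M) (x y : ℝ) : |uReg L ε u x y| ≤ M := by
  have ib := integrable_bump hL hε hε1
  have hc : Continuous fun q : ℝ × ℝ => u (x - q.1) (y - q.2) := continuous_shift hu x y
  have ibu : Integrable (fun q : ℝ × ℝ => bump L ε q.1 q.2 * u (x - q.1) (y - q.2))
      ((volume : Measure (ℝ × ℝ)).restrict (Ioc (-(L / 2)) (L / 2) ×ˢ univ)) :=
    ib.mul_bdd hc.aestronglyMeasurable (Eventually.of_forall fun q => by
      rw [Real.norm_eq_abs]; exact hM _ _)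
  unfold uReg
  rw [abs_mul, abs_of_pos (by positivity : (0:ℝ) < 1 / (4 * π))]
  calc 1 / (4 * π) * |∫ q in Ioc (-(L / 2)) (L / 2) ×ˢ univ, bump L ε q.1 q.2 * u (x - q.1) (y - q.2)|
      ≤ 1 / (4 * π) * ∫ q in Ioc (-(L / 2)) (L / 2) ×ˢ univ, bump L ε q.1 q.2 * M := by
        refine mul_le_mul_of_nonneg_left ?_ (by positivity)
        refine (abs_integral_le_integral_abs).trans (integral_mono ibu.abs (ib.mul_const M) fun q => ?_)
        show |bump L ε q.1 q.2 * u (x - q.1) (y - q.2)| ≤ bump L ε q.1 q.2 * M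
        rw [abs_mul, abs_of_nonneg (bump_nonneg hε L _ _)]
        exact mul_le_mul_of_nonneg_left (hM _ _) (bump_nonneg hε L _ _)
    _ = M := by rw [integral_mul_const, integral_bump hL hε hε1]; field_simp

/-- **`u_ε` is jointly continuous** (`0 < ε ≤ 1`, dominated convergence). [folklore] -/
theorem continuous_uReg (hL : 0 < L) (hε : 0 < ε) (hε1 : ε ≤ 1) (hu : Continuous fun p : ℝ × ℝ => u p.1 p.2)
    {M : ℝ} (hM : ∀ x y, |u x y| ≤ M) : Continuous fun p : ℝ × ℝ => uReg L ε u p.1 p.2 := by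
  unfold uReg
  refine continuous_const.mul ?_
  have ib := integrable_bump hL hε hε1
  refine continuous_of_dominated (bound := fun q => ‖bump L ε q.1 q.2‖ * M) (fun p => ?_) (fun p => ?_)
    (ib.norm.mul_const M) (Eventually.of_forall fun q => ?_)
  · exact ((continuous_bump hε L).mul (continuous_shift hu p.1 p.2)).aestronglyMeasurable
  · refine Eventually.of_forall fun q => ?_
    rw [norm_mul, Real.norm_eq_abs, Real.norm_eq_abs]
    exact mul_le_mul_of_nonneg_left (hM _ _) (abs_nonneg _)
  · exact continuous_const.mul (hu.comp ((continuous_fst.sub continuous_const).prodMk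
      (continuous_snd.sub continuous_const)))

/-- **The representation `u_ε = −(2L)⁻¹ ∫∫ K₁^ε(z − ζ) ω(ζ)`** (Green's identity at level `ε`, the cell shift,
and Fubini back to the iterated form of the line's functionals). [folklore] -/
theorem uReg_eq (hL : 0 < L) (hk : 0 < k) (hu : ContDiff ℝ 2 (fun q : ℝ × ℝ => u q.1 q.2))
    (hv : ContDiff ℝ 2 (fun q : ℝ × ℝ => v q.1 q.2)) (hdiv : ∀ x y, dX u x y + dY v x y = 0)
    (hperu : ∀ x y, u (x + L) y = u x y) (hperv : ∀ x y, v (x + L) y = v x y)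
    (htop : ∀ x, Tendsto (fun y => u x y) atTop (𝓝 (1 / 2)))
    (hbot : ∀ x, Tendsto (fun y => u x y) atBot (𝓝 (-(1 / 2)))) (hT : SliceTails C k u v) (hε : 0 < ε)
    (hε1 : ε ≤ 1) (x y : ℝ) :
    uReg L ε u x y =
      -(1 / (2 * L)) * ∫ x' in Ioc 0 L, ∫ y', kerU L ε (x - x') (y - y') * vorticity u v x' y' := by
  have hc : (0:ℝ) < 2 * π / L := by positivity
  -- iterated → product
  have iK : IntegrableOn (fun q : ℝ × ℝ => kerU L ε (x - q.1) (y - q.2) * vorticity u v q.1 q.2)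
      (Ioc 0 L ×ˢ univ) :=
    integrableOn_strip_bdd_mul_decay hk (K := fun a b => kerU L ε (x - a) (y - b)) (w := vorticity u v)
      (continuous_shift (continuous_kerU hε L) x y) (continuous_vorticity hu hv)
      (fun a b => abs_kerU_le hε L _ _) (tails_C_nonneg hT) (tails_abs_vorticity_le hT)
  have e1 : (∫ x' in Ioc 0 L, ∫ y', kerU L ε (x - x') (y - y') * vorticity u v x' y') =
      ∫ q in Ioc 0 L ×ˢ univ, kerU L ε (x - q.1) (y - q.2) * vorticity u v q.1 q.2 := by
    rw [IntegrableOn, volume_restrict_strip] at iK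
    rw [volume_restrict_strip, integral_prod _ iK]
  -- the cell shift for the bump
  have iB : IntegrableOn (fun q : ℝ × ℝ => bump L ε (x - q.1) (y - q.2) * u q.1 q.2) (Ioc 0 L ×ˢ univ) := by
    refine integrableOn_strip_decayKer_mul_bdd (K := fun a b => bump L ε (x - a) (y - b)) (w := u)
      (continuous_shift (continuous_bump hε L) x y) hu.continuous
      (A := (2 * π / L) ^ 2 * ((((2 + 2 / ε) + (2 + 2 / ε) ^ 2 + 24) * Real.exp 2) +
        ((1 / ε + (1 / ε) ^ 2 + 24) * Real.exp 2))) hc y (fun a b => ?_) (tails_abs_u_le hT hk)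
    rw [bump_eq hε, abs_mul, abs_of_pos (pow_pos hc 2), mul_assoc]
    refine mul_le_mul_of_nonneg_left ((abs_add_le _ _).trans ?_) (pow_pos hc 2).le
    have h1 := abs_kerUU_le hL hε hε1 (x - a) (y - b)
    have h2 := abs_kerVV_le hL hε hε1 (x - a) (y - b)
    linarith
  have iB' : IntegrableOn (fun q : ℝ × ℝ => bump L ε q.1 q.2 * u (x - q.1) (y - q.2))
      (Ioc (-(L / 2)) (L / 2) ×ˢ univ) :=
    (integrable_bump hL hε hε1).mul_bdd (continuous_shift hu.continuous x y).aestronglyMeasurable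
      (Eventually.of_forall fun q => by rw [Real.norm_eq_abs]; exact (tails_abs_u_le hT hk) _ _)
  have e2 := setIntegral_strip_shift hL x y (k := bump L ε) (g := u) (fun a b => bump_add_period hL.ne' ε a b)
    hperu iB iB'
  rw [e1, integral_kerU_mul_vorticity hL hk hu hv hdiv hperu hperv htop hbot hT hε hε1 x y, e2]
  unfold uReg
  field_simp
  ring

end UReg

section KernelLimit

/-- `pairKernelReg L ε δ → pairKernel L δ` as `ε → 0⁺`, at EVERY `δ`. [folklore] -/
theorem tendsto_pairKernelReg (L δx δy : ℝ) :
    Tendsto (fun ε => pairKernelReg L ε δx δy) (𝓝[>] 0) (𝓝 (pairKernel L δx δy)) := by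
  rw [← pairKernelReg_zero]
  simp only [pairKernelReg]
  set t : ℝ := 2 * π * δy / L
  set s : ℝ := 2 * π * δx / L
  by_cases hD : 2 * L * (Real.cosh t - Real.cos s) = 0
  · -- on the zero set the numerator vanishes too: the kernel is `0` for every `ε`
    have hnum : δy * Real.sinh t = 0 := by
      rcases mul_eq_zero.1 hD with h2L | hD'
      · rcases mul_eq_zero.1 h2L with h2 | hL
        · norm_num at h2
        · simp [t, hL]
      · have hc : Real.cosh t = 1 := le_antisymm (by linarith [Real.cos_le_one s]) (Real.one_le_cosh t)
        have ht0 : t = 0 := by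
          by_contra h; have := Real.one_lt_cosh.2 h; linarith
        rw [ht0, Real.sinh_zero, mul_zero]
    simp only [hnum, zero_div, add_zero]
    exact tendsto_const_nhds
  · have h1 : Tendsto (fun ε : ℝ => 2 * L * (Real.cosh t - Real.cos s + ε)) (𝓝[>] 0)
        (𝓝 (2 * L * (Real.cosh t - Real.cos s + 0))) :=
      ((tendsto_const_nhds.add tendsto_id).const_mul (2 * L)).mono_left nhdsWithin_le_nhds
    rw [add_zero] at h1 ⊢
    exact tendsto_const_nhds.div h1 hD

end KernelLimit

/-- **Green's identity at level `ε` on the period strip** (registered on stmt-AnomalousDissipation-3007 as the helper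
sub-goal `stub_momentPairKernel_greenReg` of `stub_momentPairKernel`): for a `C²`, divergence-free, `L`-periodic
slice with the shear far field `u → ±½` and shear tails, and `0 < ε ≤ 1`,
`∫_cell K₁^ε(z − ζ) ω(ζ) dζ = −(L/2π) ∫_cell ΔΦ_ε^L(z − ζ) u(ζ) dζ` with the regularised cylinder kernels written
out (`integral_kerU_mul_vorticity`). [folklore] -/
theorem stub_momentPairKernel_greenReg : ∀ (L C k ε : ℝ), 0 < L → 0 < k → 0 < ε → ε ≤ 1 → ∀ (u v : ℝ → ℝ → ℝ),
    ContDiff ℝ 2 (fun q : ℝ × ℝ => u q.1 q.2) → ContDiff ℝ 2 (fun q : ℝ × ℝ => v q.1 q.2) →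
    (∀ x y, dX u x y + dY v x y = 0) →
    (∀ x y, u (x + L) y = u x y) → (∀ x y, v (x + L) y = v x y) →
    (∀ x, Tendsto (fun y => u x y) atTop (𝓝 (1 / 2))) →
    (∀ x, Tendsto (fun y => u x y) atBot (𝓝 (-(1 / 2)))) →
    SliceTails C k u v → ∀ x y : ℝ,
      ∫ q in Ioc 0 L ×ˢ univ, Real.sinh (2 * Real.pi * (y - q.2) / L) /
          (Real.cosh (2 * Real.pi * (y - q.2) / L) - Real.cos (2 * Real.pi * (x - q.1) / L) + ε) *
            vorticity u v q.1 q.2 =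
        -(L / (2 * Real.pi)) * ∫ q in Ioc 0 L ×ˢ univ, (2 * Real.pi / L) ^ 2 *
          (ε * (Real.cosh (2 * Real.pi * (y - q.2) / L) + Real.cos (2 * Real.pi * (x - q.1) / L)) /
            (Real.cosh (2 * Real.pi * (y - q.2) / L) - Real.cos (2 * Real.pi * (x - q.1) / L) + ε) ^ 2) *
              u q.1 q.2 :=
  fun _ _ _ _ hL hk hε hε1 _ _ hu hv hdiv hperu hperv htop hbot hT x y =>
    integral_kerU_mul_vorticity hL hk hu hv hdiv hperu hperv htop hbot hT hε hε1 x y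

end Summit.AnomalousDissipation.AnomalousDissipation.Theorems.StrainedLayerLaw.StrainWorkSumRule

end
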